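import Summits.CriticalPhenomena.PercolationContinuityZ3.Theorems.SahiMasterFamilyStructShrink
import Summits.CriticalPhenomena.PercolationContinuityZ3.Theorems.SahiMasterFamilyFrameCoreStep

/-!
# Structure theory of the zero-flag class, VIII: Sahi positivity on structured cores, every order

Unit `prim-master-conj` (crux anchor stmt-CriticalPhenomena-4575); STRUCTURE-THEORY.md §4.1 (gen 6).  For a structured family `W` (any
size), ANY further increasing event (index `d ∉ W`) and ANY enumeration `V` of `insert d W`:
`0 ≤ E(μ_p; 1_{U (V 0)}, …)` for every `p ∈ [0,1]^ι` (`sahiE_nonneg_of_structured`), together with the STEP INEQUALITY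
`sahiE_step_of_structured`: for a member `v` with non-empty annihilator `N_v`,
`E(U ∘ V) ≥ E(U[v ↦ frame] ∘ V) + μ_p(N_v) · E(U ∘ Vm)` (`Vm` = the enumeration without `v`), both terms nonnegative.
Proof: move `v` to the front, `1_{U v} = 1_{A_v} − 1_{N_v}`, block expansion of the `N_v` slot (`sahiE_cons_eq_block_expansion`): the
top term dies because `N_v` is safe, every other term is (nonnegative coefficient) × E(structured sub-core [, D]) — zero if `D` was
absorbed (`suppZeroFlag_of_structured`), nonnegative by induction otherwise; induction on (size, number of non-pure members), the base
being the tree's frame positivity `sahiE_ind_nonneg_of_frame`.  Axioms standard. [this work]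
-/

noncomputable section

open scoped Classical

namespace Summit.CriticalPhenomena.PercolationContinuityZ3.Theorems

open Finset Function MeasureTheory
open Literature.Combinatorics.Sahi2008
open Literature.Probability.LatticeModels (prodBernoulli)
open Literature.Probability.LatticeModels.Kahn2022 (Affects)
open Literature.Probability.Percolation.DecisionTree (ind ind_of_mem ind_of_not_mem ind_nonneg)

variable {ι : Type} [Fintype ι] {κ : Type*} (U : κ → Set (Set ι))

/-! ### Bookkeeping -/

/-- The non-pure members of a family: those whose canonical frame is strictly bigger than the member. [this work] -/
def nonpure (W : Finset κ) : Finset κ := W.filter fun w => ¬ (cframe U W w ⊆ U w)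

/-- Membership in `nonpure`. [this work] -/
theorem mem_nonpure {W : Finset κ} {w : κ} : w ∈ nonpure U W ↔ w ∈ W ∧ ¬ (cframe U W w ⊆ U w) := by simp [nonpure]

/-- **Pure replacement**: every member of `W` replaced by its canonical frame (other indices unchanged). [this work] -/
def pureRepl (W : Finset κ) : κ → Set (Set ι) := fun k => if k ∈ W then cframe U W k else U k

/-- `Z ⊆`-lemma in any size `≥ 2` (propositional size). [this work] -/
theorem sahiE_eq_zero_of_structured (p : ι → unitInterval) (hU : ∀ k, IsUpperSet (U k)) (hne : ∀ k, (U k).Nonempty) {c : ℕ} (hc : 2 ≤ c)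
    (V : Fin c → κ) (hV : Injective V) (hW : Structured U (univ.image V)) : sahiE (bernoulliWeight p) c (fun j => ind (U (V j))) = 0 := by
  obtain ⟨k, rfl⟩ : ∃ k, c = k + 2 := ⟨c - 2, by omega⟩
  exact sahiE_ind_eq_zero_of_suppZeroFlag p (suppZeroFlag_of_structured k U hU hne V hV hW)

omit [Fintype ι] in
/-- Image of the enumeration with one slot deleted. [this work] -/
theorem image_succAbove_eq_erase {c : ℕ} (V : Fin (c + 1) → κ) (hV : Injective V) (i : Fin (c + 1)) :
    univ.image (fun j => V (i.succAbove j)) = (univ.image V).erase (V i) := by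
  ext x
  simp only [mem_image, mem_univ, true_and, mem_erase]
  constructor
  · rintro ⟨j, rfl⟩; exact ⟨fun h => Fin.succAbove_ne i j (hV h), ⟨_, rfl⟩⟩
  · rintro ⟨hx, ⟨j, rfl⟩⟩
    obtain ⟨j', rfl⟩ := Fin.exists_succAbove_eq (show j ≠ i from fun h => hx (by rw [h]))
    exact ⟨j', rfl⟩

/-- `1_Y = 1_A − 1_{A ∖ Y}` inside `E`, head slot. [this work] -/
theorem sahiE_cons_ind_eq_sub (μ : Set ι → ℝ) {q : ℕ} (G : Fin q → Set ι → ℝ) {Y A : Set (Set ι)} (h : Y ⊆ A) :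
    sahiE μ (q + 1) (Fin.cons (ind Y) G : Fin (q + 1) → Set ι → ℝ) =
      sahiE μ (q + 1) (Fin.cons (ind A) G : Fin (q + 1) → Set ι → ℝ) -
        sahiE μ (q + 1) (Fin.cons (ind (A \ Y)) G : Fin (q + 1) → Set ι → ℝ) := by
  have key := sahiE_update_lin μ (q + 1) (Fin.cons (ind Y) G) 0 1 (-1) (ind A) (ind (A \ Y))
  simp only [Fin.update_cons_zero] at key
  have e : (1 : ℝ) • ind A + (-1 : ℝ) • ind (A \ Y) = ind Y := by
    rw [ind_diff_eq_sub h, one_smul, neg_one_smul]; abel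
  rw [e] at key
  rw [key]; ring

/-! ### The expansion step -/

/-- **The expansion step.**  Chain `v :: l₂` good, `d ∉ W := insert v l₂.toFinset`, `V` an enumeration of `insert d W` with `V i = v`,
`G` the rest; `A` = frame of `v`, `N = A ∖ U v`.  If every structured sub-family `R ⊆ l₂.toFinset` together with `d` has `E ≥ 0`
(induction hypothesis), then `E(1_N, G) ≤ −μ(N)·E(G)`. [this work] -/
theorem sahiE_cons_annihilator_le (p : ι → unitInterval) (hU : ∀ k, IsUpperSet (U k)) (hne : ∀ k, (U k).Nonempty) {v d : κ}
    {l₂ : List κ} (hvl : GoodChain U (v :: l₂)) (hd : d ∉ insert v l₂.toFinset) {n : ℕ} (Vm : Fin (n + 1) → κ) (hVm : Injective Vm)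
    (himg : univ.image Vm = insert d l₂.toFinset)
    (IH : ∀ R : Finset κ, R ⊆ l₂.toFinset → Structured U R → R.Nonempty → ∀ (c : ℕ) (V' : Fin c → κ), Injective V' →
      univ.image V' = insert d R → 0 ≤ sahiE (bernoulliWeight p) c (fun j => ind (U (V' j)))) :
    sahiE (bernoulliWeight p) (n + 2)
        (Fin.cons (ind (hull (frameSupp U l₂) (U v) \ U v)) (fun j => ind (U (Vm j))) : Fin (n + 2) → Set ι → ℝ) ≤
      -((prodBernoulli p).real (hull (frameSupp U l₂) (U v) \ U v) * sahiE (bernoulliWeight p) (n + 1) (fun j => ind (U (Vm j)))) := by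
  set N := hull (frameSupp U l₂) (U v) \ U v with hNdef
  set G : Fin (n + 1) → Set ι → ℝ := fun j => ind (U (Vm j)) with hGdef
  have hNsafe : N ⊆ Safe U l₂.toFinset := ((goodChain_cons U).1 hvl).2.2
  have hmem : ∀ w ∈ l₂.toFinset, ∃ j, Vm j = w := fun w hw => by
    have : w ∈ univ.image Vm := by rw [himg]; exact mem_insert_of_mem hw
    simpa [mem_image] using this
  rw [sahiE_cons_eq_block_expansion]
  -- top term vanishes: a safe configuration fails at least one member of `l₂`
  have htop : ex (bernoulliWeight p) (ind N * ∏ j, G j) = 0 := by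
    obtain ⟨e, -⟩ := ex_ind_mul_prod_ind_nonneg p N (fun j => U (Vm j)) univ
    have e' : (ind N * ∏ j, G j) = ind N * ∏ j ∈ univ, ind (U (Vm j)) := rfl
    rw [e', e]
    have h0 : N ∩ ⋂ t ∈ (univ : Finset (Fin (n + 1))), U (Vm t) = ∅ := by
      refine Set.eq_empty_of_forall_notMem fun ω hω => ?_
      obtain ⟨hωN, hωI⟩ := hω
      obtain ⟨h2, -⟩ := (mem_safe U).1 (hNsafe hωN)
      obtain ⟨w, hw⟩ : (failSet U l₂.toFinset ω).Nonempty := card_pos.1 (by omega)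
      rw [mem_failSet] at hw
      obtain ⟨j, hj⟩ := hmem w hw.1
      apply hw.2
      rw [← hj]
      exact (Set.mem_iInter₂.1 hωI) j (mem_univ j)
    rw [h0]; exact ex_ind_empty _
  rw [htop, mul_zero, zero_sub, neg_le_neg_iff]
  -- the `T = ∅` term is `μ(N)·E(G)`; all terms are ≥ 0
  have hterm : ∀ T ∈ (univ : Finset (Fin (n + 1))).powerset.erase univ,
      0 ≤ (T.card.factorial : ℝ) * ex (bernoulliWeight p) (ind N * ∏ i ∈ T, G i) *
        sahiE (bernoulliWeight p) ((univ : Finset (Fin (n + 1))) \ T).card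
          (fun i => G (((univ : Finset (Fin (n + 1))) \ T).orderEmbOfFin rfl i)) := by
    intro T _
    obtain ⟨eT, hcoef⟩ := ex_ind_mul_prod_ind_nonneg p N (fun j => U (Vm j)) T
    have eT' : (ind N * ∏ i ∈ T, G i) = ind N * ∏ t ∈ T, ind (U (Vm t)) := rfl
    rw [eT'] at *
    by_cases hempty : N ∩ ⋂ t ∈ T, U (Vm t) = ∅
    · rw [eT, hempty, ex_ind_empty, mul_zero, zero_mul]
    · refine mul_nonneg (mul_nonneg (Nat.cast_nonneg _) hcoef) ?_
      obtain ⟨ω, hωN, hωT⟩ := Set.nonempty_iff_ne_empty.2 hempty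
      -- the sub-enumeration and its image
      set s₀ : Finset (Fin (n + 1)) := univ \ T with hs₀
      set VT : Fin s₀.card → κ := fun i => Vm (s₀.orderEmbOfFin rfl i) with hVT
      have hVTinj : Injective VT := fun a b h => (s₀.orderEmbOfFin rfl).injective (hVm h)
      set R : Finset κ := (univ.image VT).erase d with hRdef
      have hRsub : R ⊆ l₂.toFinset := by
        intro x hx
        rw [hRdef, mem_erase, hVT, mem_image] at hx
        obtain ⟨hxd, ⟨a, -, rfl⟩⟩ := hx
        have : Vm (s₀.orderEmbOfFin rfl a) ∈ univ.image Vm := mem_image_of_mem _ (mem_univ _)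
        rw [himg, mem_insert] at this
        exact this.resolve_left hxd
      -- members failing at `ω` lie in `R`
      have hfail : failSet U l₂.toFinset ω ⊆ R := by
        intro w hw
        rw [mem_failSet] at hw
        obtain ⟨j, hj⟩ := hmem w hw.1
        have hjT : j ∉ T := by
          intro hjT; apply hw.2; rw [← hj]; exact (Set.mem_iInter₂.1 hωT) j hjT
        have hjs : j ∈ s₀ := by rw [hs₀, mem_sdiff]; exact ⟨mem_univ j, hjT⟩
        obtain ⟨a, ha⟩ : ∃ a : Fin s₀.card, s₀.orderEmbOfFin rfl a = j := by
          have : j ∈ Set.range (s₀.orderEmbOfFin rfl) := by rw [range_orderEmbOfFin]; exact hjs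
          exact this
        rw [hRdef, mem_erase]
        refine ⟨fun h => hd ?_, mem_image.2 ⟨a, mem_univ a, by rw [hVT]; simp only; rw [ha, hj]⟩⟩
        rw [← h]; exact mem_insert_of_mem hw.1
      obtain ⟨h2, hsup⟩ := (mem_safe U).1 (hNsafe hωN)
      have hRs : Structured U R := hsup R hfail hRsub
      have hRne : R.Nonempty := card_pos.1 (lt_of_lt_of_le (by omega) (card_le_card hfail))
      by_cases hdim : d ∈ univ.image VT
      · -- `d` kept: induction hypothesis on the structured sub-core `R`
        have himg' : univ.image VT = insert d R := by rw [hRdef, insert_erase hdim]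
        exact IH R hRsub hRs hRne _ VT hVTinj himg'
      · -- `d` absorbed: the sub-family is exactly `R`, a zero family
        have himg' : univ.image VT = R := by rw [hRdef, erase_eq_of_notMem hdim]
        have hc2 : 2 ≤ s₀.card := by
          have : R.card ≤ s₀.card := by
            rw [← himg']; exact card_image_le.trans (by simp)
          exact le_trans (h2.trans (card_le_card hfail)) this
        rw [sahiE_eq_zero_of_structured U p hU hne hc2 VT hVTinj (himg'.symm ▸ hRs)]
  have hmem0 : (∅ : Finset (Fin (n + 1))) ∈ (univ : Finset (Fin (n + 1))).powerset.erase univ := by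
    rw [mem_erase]
    exact ⟨fun h0 => absurd (h0 ▸ mem_univ (0 : Fin (n + 1))) (notMem_empty _), empty_mem_powerset _⟩
  have h0term : ((∅ : Finset (Fin (n + 1))).card.factorial : ℝ) * ex (bernoulliWeight p) (ind N * ∏ i ∈ (∅ : Finset (Fin (n + 1))), G i) *
      sahiE (bernoulliWeight p) ((univ : Finset (Fin (n + 1))) \ ∅).card
        (fun i => G (((univ : Finset (Fin (n + 1))) \ ∅).orderEmbOfFin rfl i)) =
      (prodBernoulli p).real N * sahiE (bernoulliWeight p) (n + 1) G := by
    rw [card_empty, Nat.factorial_zero, Nat.cast_one, one_mul, prod_empty, mul_one, ex_bernoulliWeight_ind,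
      ← sahiE_eq_subfamily_univ]
  rw [← h0term]
  exact single_le_sum hterm hmem0

/-! ### Positivity and the step inequality -/

/-- **Sahi positivity on structured cores, every order** (STRUCTURE-THEORY 4.1, P): for a nonempty structured family `W`, an index
`d ∉ W` (the free event `U d`), and any enumeration `V` of `insert d W`, `0 ≤ E(μ_p; 1_{U (V j)})` for every `p ∈ [0,1]^ι`; moreover the
STEP INEQUALITY for a non-pure member `v = V i`: `E(U ∘ V) ≥ μ_p(N_v) · E(U ∘ V ∘ i.succAbove)`. [this work] -/
theorem sahiE_nonneg_of_structured_aux (p : ι → unitInterval) :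
    ∀ (s μ : ℕ) (U : κ → Set (Set ι)), (∀ k, IsUpperSet (U k)) → (∀ k, (U k).Nonempty) → ∀ (W : Finset κ) (d : κ), d ∉ W →
      Structured U W → W.Nonempty → W.card ≤ s → (nonpure U W).card ≤ μ → ∀ (c : ℕ) (V : Fin c → κ), Injective V →
        univ.image V = insert d W → 0 ≤ sahiE (bernoulliWeight p) c (fun j => ind (U (V j))) ∧
          sahiE (bernoulliWeight p) c (fun j => ind (pureRepl U W (V j))) ≤ sahiE (bernoulliWeight p) c (fun j => ind (U (V j)))
  | 0, _, U, _, _, W, d, _, _, hWne, hWs, _, c, V, _, _ => by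
    rw [Nat.le_zero, card_eq_zero] at hWs; exact absurd hWs hWne.ne_empty
  | s + 1, μ, U, hU, hne, W, d, hd, hW, hWne, hWs, hμ, c, V, hV, himg => by
    -- size bookkeeping: c = W.card + 1 ≥ 2
    have hc : c = W.card + 1 := by
      have := card_image_of_injective univ hV
      rw [card_univ, Fintype.card_fin, himg, card_insert_of_notMem hd] at this; exact this.symm
    obtain ⟨n, rfl⟩ : ∃ n, c = n + 2 := ⟨c - 2, by have := hWne.card_pos; omega⟩
    have hmemV : ∀ x ∈ insert d W, ∃ j, V j = x := fun x hx => by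
      have : x ∈ univ.image V := by rw [himg]; exact hx
      simpa [mem_image] using this
    by_cases hpure : nonpure U W = ∅
    · -- all members pure: an independent frame plus the free event `U d`; the pure replacement is the family itself
      have hpr : (fun j => ind (pureRepl U W (V j))) = fun j => ind (U (V j)) := by
        funext j
        by_cases hjW : V j ∈ W
        · have pj : cframe U W (V j) = U (V j) := by
            refine Set.Subset.antisymm ?_ (subset_cframe U hU W _)
            by_contra h; exact (notMem_empty (V j)) (hpure ▸ ((mem_nonpure U).2 ⟨hjW, h⟩ : V j ∈ nonpure U W))
          simp [pureRepl, hjW, pj]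
        · simp [pureRepl, hjW]
      rw [hpr]
      refine ⟨?_, le_rfl⟩
      obtain ⟨s₀, hs₀⟩ := hmemV d (mem_insert_self d W)
      refine sahiE_ind_nonneg_of_frame p (fun j => U (V j)) (fun j => hU _) s₀ fun j j' hj hj' hjj' => ?_
      have hjW : V j ∈ W := (mem_insert.1 (himg ▸ mem_image_of_mem V (mem_univ j))).resolve_left
        (fun h => hj (hV (h.trans hs₀.symm)))
      have hj'W : V j' ∈ W := (mem_insert.1 (himg ▸ mem_image_of_mem V (mem_univ j'))).resolve_left
        (fun h => hj' (hV (h.trans hs₀.symm)))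
      have pj : cframe U W (V j) = U (V j) := by
        refine Set.Subset.antisymm ?_ (subset_cframe U hU W _)
        by_contra h; exact (notMem_empty (V j)) (hpure ▸ ((mem_nonpure U).2 ⟨hjW, h⟩ : V j ∈ nonpure U W))
      have pj' : cframe U W (V j') = U (V j') := by
        refine Set.Subset.antisymm ?_ (subset_cframe U hU W _)
        by_contra h; exact (notMem_empty (V j')) (hpure ▸ ((mem_nonpure U).2 ⟨hj'W, h⟩ : V j' ∈ nonpure U W))
      rw [← pj, ← pj']
      exact disjoint_esupp_cframe U hU hne hW hjW hj'W (fun h => hjj' (hV h))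
    · -- a non-pure member `v`: expand its annihilator
      obtain ⟨v, hv⟩ := nonempty_of_ne_empty hpure
      rw [mem_nonpure] at hv
      obtain ⟨hvW, hvN⟩ := hv
      have hWv : Structured U (W.erase v) := structured_erase_of_not_subset U hU hne hW hvW hvN
      obtain ⟨l₂, hl₂W, hl₂⟩ := id hWv
      have hvl : GoodChain U (v :: l₂) := goodChain_cons_of_structured_erase U hU hne hW hvW hl₂W hl₂
      have hvl₂ : v ∉ l₂ := ((goodChain_cons U).1 hvl).2.1
      have hA : hull (frameSupp U l₂) (U v) = cframe U W v := hull_frameSupp_erase U hU hne hW hvW hl₂W hl₂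
      set A := cframe U W v with hAdef
      set N := A \ U v with hNdef
      have hAu : IsUpperSet A := isUpperSet_cframe U hU W v
      have hvA : U v ⊆ A := subset_cframe U hU W v
      -- move `v` to the front
      obtain ⟨i, hi⟩ := hmemV v (mem_insert_of_mem hvW)
      set Vm : Fin (n + 1) → κ := fun j => V (i.succAbove j) with hVmdef
      have hVm : Injective Vm := fun a b h => Fin.succAbove_right_injective (hV h)
      have himgm : univ.image Vm = insert d l₂.toFinset := by
        rw [hVmdef, image_succAbove_eq_erase V hV i, himg, hi, erase_insert_of_ne (fun h => by subst h; exact hd hvW), hl₂W]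
      have hdl : d ∉ insert v l₂.toFinset := by rw [hl₂W, insert_erase hvW]; exact hd
      have emove : sahiE (bernoulliWeight p) (n + 2) (fun j => ind (U (V j))) =
          sahiE (bernoulliWeight p) (n + 2) (Fin.cons (ind (U v)) (fun j => ind (U (Vm j))) : Fin (n + 2) → Set ι → ℝ) := by
        rw [sahiE_eq_cons_succAbove _ n _ i, hi]
      -- the induction hypothesis for sub-cores
      have IH : ∀ R : Finset κ, R ⊆ l₂.toFinset → Structured U R → R.Nonempty → ∀ (c : ℕ) (V' : Fin c → κ), Injective V' →
          univ.image V' = insert d R → 0 ≤ sahiE (bernoulliWeight p) c (fun j => ind (U (V' j))) := by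
        intro R hR hRs hRne c V' hV' himg'
        refine (sahiE_nonneg_of_structured_aux p s (nonpure U R).card U hU hne R d (fun h => hd ?_) hRs hRne ?_ le_rfl c V' hV'
          himg').1
        · rw [hl₂W] at hR; exact mem_of_mem_erase (hR h)
        · have : R.card ≤ (W.erase v).card := card_le_card (hl₂W ▸ hR)
          rw [card_erase_of_mem hvW] at this; omega
      -- Term 2: the annihilator part is ≤ −μ(N)·E(rest) ≤ 0
      have hT2 := sahiE_cons_annihilator_le U p hU hne hvl hdl Vm hVm himgm IH
      rw [hA] at hT2
      have hrest : 0 ≤ sahiE (bernoulliWeight p) (n + 1) (fun j => ind (U (Vm j))) := by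
        have hl₂ne : l₂.toFinset.Nonempty := by
          rw [hl₂W]; by_contra h0; rw [not_nonempty_iff_eq_empty] at h0
          -- if `W = {v}` then `v` would be pure (its annihilator is safe for the empty family)
          have hs0 : Safe U (W.erase v) = ∅ := safe_eq_empty_of_card_le_one U (by rw [h0]; simp)
          have hNs := annihilator_subset_safe_erase U hU hne hW hvW hWv
          rw [hs0, Set.subset_empty_iff, Set.sdiff_eq_empty] at hNs
          exact hvN hNs
        exact IH l₂.toFinset subset_rfl ⟨l₂, rfl, hl₂⟩ hl₂ne _ Vm hVm himgm
      -- Term 1: `v` replaced by its frame — one non-pure member fewer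
      set U₁ := update U v A with hU₁def
      have hU₁u : ∀ k, IsUpperSet (U₁ k) := by
        intro k; by_cases hk : k = v
        · subst hk; rw [hU₁def, update_self]; exact hAu
        · rw [hU₁def, update_of_ne hk]; exact hU k
      have hU₁ne : ∀ k, (U₁ k).Nonempty := by
        intro k; by_cases hk : k = v
        · subst hk; rw [hU₁def, update_self]; exact (hne k).mono hvA
        · rw [hU₁def, update_of_ne hk]; exact hne k
      have hagree : ∀ w ∈ l₂, U w = U₁ w := fun w hw => by
        have hwv : w ≠ v := fun h => by subst h; exact hvl₂ hw
        rw [hU₁def, update_of_ne hwv]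
      have hvl₁ : GoodChain U₁ (v :: l₂) := by
        rw [goodChain_cons]
        refine ⟨(goodChain_congr hagree).1 hl₂, hvl₂, ?_⟩
        rw [← frameSupp_congr hagree, hU₁def, update_self, ← hA, hull_hull, Set.union_self, sdiff_self]
        exact bot_le
      have hW₁ : Structured U₁ W := ⟨v :: l₂, by rw [List.toFinset_cons, hl₂W, insert_erase hvW], hvl₁⟩
      have eT : (v :: l₂).toFinset = W := by rw [List.toFinset_cons, hl₂W, insert_erase hvW]
      -- the canonical frames do not change
      have hcf : ∀ w ∈ W, cframe U₁ W w = cframe U W w := by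
        intro w hwW
        by_cases hwv : w = v
        · subst hwv
          show cframe U₁ W w = A
          rw [← eT, ← frameIn_eq_cframe U₁ hU₁u hU₁ne hvl₁ (List.mem_cons_self), frameIn_cons_self,
            ← frameSupp_congr hagree, hU₁def, update_self, ← hA, hull_hull, Set.union_self]
        · have hwl : w ∈ l₂ := List.mem_toFinset.1 (by rw [hl₂W]; exact mem_erase.2 ⟨hwv, hwW⟩)
          rw [← eT, ← frameIn_eq_cframe U₁ hU₁u hU₁ne hvl₁ (List.mem_cons_of_mem v hwl), frameIn_cons_of_ne U₁ hwv,
            ← frameIn_congr hagree hwl, frameIn_eq_cframe U hU hne hl₂ hwl, hl₂W,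
            cframe_erase U hU hne hW hWv (mem_erase.2 ⟨hwv, hwW⟩), eT]
      have hμ₁ : (nonpure U₁ W).card ≤ μ - 1 := by
        have hsub : nonpure U₁ W ⊆ (nonpure U W).erase v := by
          intro w hw
          rw [mem_nonpure] at hw
          obtain ⟨hwW, hwN⟩ := hw
          rw [mem_erase, mem_nonpure]
          rw [hcf w hwW] at hwN
          by_cases hwv : w = v
          · subst hwv
            exfalso; apply hwN
            rw [hU₁def, update_self]
          · refine ⟨hwv, hwW, fun h => hwN ?_⟩
            rw [hU₁def, update_of_ne hwv]; exact h
        have := card_le_card hsub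
        rw [card_erase_of_mem ((mem_nonpure U).2 ⟨hvW, hvN⟩)] at this
        omega
      have hpr₁ : (fun j => ind (pureRepl U₁ W (V j))) = fun j => ind (pureRepl U W (V j)) := by
        funext j
        by_cases hjW : V j ∈ W
        · simp only [pureRepl, hjW, if_true, hcf (V j) hjW]
        · have hjd : V j = d := (mem_insert.1 (himg ▸ mem_image_of_mem V (mem_univ j))).resolve_right hjW
          have hdv : d ≠ v := fun h => by subst h; exact hd hvW
          have e1 : pureRepl U₁ W (V j) = U₁ (V j) := by simp only [pureRepl, hjW, if_false]
          have e2 : pureRepl U W (V j) = U (V j) := by simp only [pureRepl, hjW, if_false]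
          rw [e1, e2, hjd, hU₁def, update_of_ne hdv]
      have hμpos : 0 < μ := by
        have : 0 < (nonpure U W).card := card_pos.2 ⟨v, (mem_nonpure U).2 ⟨hvW, hvN⟩⟩
        omega
      have hT1 : 0 ≤ sahiE (bernoulliWeight p) (n + 2) (fun j => ind (U₁ (V j))) ∧
          sahiE (bernoulliWeight p) (n + 2) (fun j => ind (pureRepl U₁ W (V j))) ≤
            sahiE (bernoulliWeight p) (n + 2) (fun j => ind (U₁ (V j))) := by
        -- induction on `μ` (same `s`)
        have : ∀ μ' : ℕ, μ' < μ → (nonpure U₁ W).card ≤ μ' → 0 ≤ sahiE (bernoulliWeight p) (n + 2) (fun j => ind (U₁ (V j))) ∧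
            sahiE (bernoulliWeight p) (n + 2) (fun j => ind (pureRepl U₁ W (V j))) ≤
              sahiE (bernoulliWeight p) (n + 2) (fun j => ind (U₁ (V j))) :=
          fun μ' _ hμ' => sahiE_nonneg_of_structured_aux p (s + 1) μ' U₁ hU₁u hU₁ne W d hd hW₁ hWne hWs hμ' _ V hV himg
        exact this (μ - 1) (by omega) hμ₁
      rw [hpr₁] at hT1
      have emove₁ : sahiE (bernoulliWeight p) (n + 2) (fun j => ind (U₁ (V j))) =
          sahiE (bernoulliWeight p) (n + 2) (Fin.cons (ind A) (fun j => ind (U (Vm j))) : Fin (n + 2) → Set ι → ℝ) := by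
        rw [sahiE_eq_cons_succAbove _ n _ i, hi]
        congr 1
        funext j
        refine Fin.cases ?_ (fun j' => ?_) j
        · simp [hU₁def]
        · simp only [Fin.cons_succ, hVmdef]
          rw [hU₁def, update_of_ne (fun h => Fin.succAbove_ne i j' (hV (h.trans hi.symm)))]
      -- assemble
      rw [emove, sahiE_cons_ind_eq_sub _ _ hvA, ← emove₁]
      have hμN : 0 ≤ (prodBernoulli p).real (A \ U v) := measureReal_nonneg
      have hprod := mul_nonneg hμN hrest
      constructor
      · nlinarith [hT1.1, hT2, hprod]
      · nlinarith [hT1.2, hT2, hprod]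
termination_by s μ => (s, μ)

/-- **Sahi positivity on structured cores, every order, every product measure** (STRUCTURE-THEORY P). [this work] -/
theorem sahiE_nonneg_of_structured (p : ι → unitInterval) (hU : ∀ k, IsUpperSet (U k)) (hne : ∀ k, (U k).Nonempty) {W : Finset κ}
    {d : κ} (hd : d ∉ W) (hW : Structured U W) (hWne : W.Nonempty) {c : ℕ} (V : Fin c → κ) (hV : Injective V)
    (himg : univ.image V = insert d W) : 0 ≤ sahiE (bernoulliWeight p) c (fun j => ind (U (V j))) :=
  (sahiE_nonneg_of_structured_aux p W.card (nonpure U W).card U hU hne W d hd hW hWne le_rfl le_rfl c V hV himg).1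

/-- **The pure replacement lowers `E`**: replacing every member of the structured core by its canonical frame does not increase Sahi's
functional; in particular `E = 0` forces `E(frames, D) = 0` ([F] of STRUCTURE-THEORY 4.2). [this work] -/
theorem sahiE_pureRepl_le (p : ι → unitInterval) (hU : ∀ k, IsUpperSet (U k)) (hne : ∀ k, (U k).Nonempty) {W : Finset κ}
    {d : κ} (hd : d ∉ W) (hW : Structured U W) (hWne : W.Nonempty) {c : ℕ} (V : Fin c → κ) (hV : Injective V)
    (himg : univ.image V = insert d W) :
    sahiE (bernoulliWeight p) c (fun j => ind (pureRepl U W (V j))) ≤ sahiE (bernoulliWeight p) c (fun j => ind (U (V j))) :=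
  (sahiE_nonneg_of_structured_aux p W.card (nonpure U W).card U hU hne W d hd hW hWne le_rfl le_rfl c V hV himg).2

end Summit.CriticalPhenomena.PercolationContinuityZ3.Theorems
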